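import Mathlib
import HarnessLib
import Literature.RingTheory.CohomologyAnnihilator.Basic
import Literature.RingTheory.CohomologyAnnihilator.Localization
import Literature.RingTheory.CohomologyAnnihilator.RegularLocalRing
import Summits.ResolutionOfSingularities.ResolutionOfSingularities.Theorems.HomologicalConductorPersistencePeriodicSaturationLocal

/-!
# Periodic saturation — STAGE ADAPTER: from `ca(U⁻¹B) = caᵈ⁺¹(U⁻¹B)` to the route's `ca T ⊆ caAt n T`

Route `ResolutionOfSingularities/HomologicalConductor`, chain W4.4b, rung S-2 `PersistenceSurface`
(stmt-ResolutionOfSingularities-19970); consumer-side glue for the o9 triple (p506413 hypersurface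
periodicity · p507177 periodic saturation · p508342 localised form) toward the Sat₄ columns of o3
`SaturationFourSurface` (p503336) / o6 `SaturationFourRational` (p505465) and the named assembly o11.
[OURS · L1 w44b · res-type-011; AI-written, weaker than expert review; NOT a statement of the manuscript
under study, and no statement of that manuscript is used.]

* `cohomologyAnnihilator_le_of_ringEquiv` / `cohomologyAnnihilator_eq_of_ringEquiv` — `ca ⊆ caⁿ`
  (`=`) transports along `T ≃+* T'`;
* `cohomologyAnnihilator_eq_of_isLocalization_powerBasis` — o9c for any `IsLocalization U C`;
  `cohomologyAnnihilator_eq_of_ringEquiv_localization_powerBasis` — for any `T ≃+* U⁻¹B`;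
* `ca_subset_caAt_of_le` — the ROUTE-VOCABULARY adapter: for a subalgebra stage `T ⊆ K`,
  `ca(↥T) ⊆ caⁿ(↥T)` gives the inclusion of the route file's inline sets `ca T ⊆ caAt n T`;
* `cohomologyAnnihilator_eq_of_isLocalization_powerBasis_of_isRegularLocalRing` — regular LOCAL base `S`;
  `ca_subset_caAt_of_isRegularLocalRing` — `Satₙ` is trivial at regular stages (`caⁿ = ⊤`, `n ≥ dim + 1`);
* `ca_subset_caAt_of_ringEquiv_localization_powerBasis` (`n ≥ d + 1`) and the surface form
  `ca_subset_caAt_four_of_ringEquiv_localization_adjoinRoot` (`d = 2`, base `k₀[x,y]`, level `4`):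
  the `m`-th conjunct of `SaturationFour…` at a stage identified with a local ring of a hypersurface chart.

What this is NOT: the identification `↥(tower A m) ≃+* U⁻¹(k₀[x,y][Z]/(f))` of an actual tower stage
(normalisation + chart algebra + Noether/Weierstrass normalisation of `f`) — that is the assembly's input.
-/

noncomputable section

-- single-problem summit: the doubled namespace component `ResolutionOfSingularities` is forced
set_option linter.dupNamespace false

namespace Summit.ResolutionOfSingularities.ResolutionOfSingularities.Theorems.HomologicalConductor.PeriodicSaturationStage

open CategoryTheory CategoryTheory.Abelian Literature.RingTheory.CohomologyAnnihilator
open Summit.ResolutionOfSingularities.ResolutionOfSingularities.Theorems.HomologicalConductor.PeriodicSaturation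
open Summit.ResolutionOfSingularities.ResolutionOfSingularities.Theorems.HomologicalConductor.PeriodicSaturationLocal

universe u

section Transport

variable {T T' : Type u} [CommRing T] [CommRing T']

/-- **`ca` saturation transports along ring isomorphisms**: if `ca(T') ⊆ caⁿ(T')` and `T ≃+* T'`
then `ca(T) ⊆ caⁿ(T)` (elementwise transport `ringEquiv_apply_mem_cohomologyAnnihilatorOfDegree`,
tree `Localization.lean`). [folklore] -/
theorem cohomologyAnnihilator_le_of_ringEquiv (e : T ≃+* T') {n : ℕ}
    (h : cohomologyAnnihilator T' ≤ cohomologyAnnihilatorOfDegree T' n) :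
    cohomologyAnnihilator T ≤ cohomologyAnnihilatorOfDegree T n := by
  intro x hx
  obtain ⟨m, hm⟩ := mem_cohomologyAnnihilator_iff.mp hx
  have h1 : e x ∈ cohomologyAnnihilator T' :=
    cohomologyAnnihilatorOfDegree_le m (ringEquiv_apply_mem_cohomologyAnnihilatorOfDegree e hm)
  have h2 := ringEquiv_apply_mem_cohomologyAnnihilatorOfDegree e.symm (h h1)
  simpa using h2

/-- `ca(T') = caⁿ(T')` and `T ≃+* T'` give `ca(T) = caⁿ(T)`. [folklore] -/
theorem cohomologyAnnihilator_eq_of_ringEquiv (e : T ≃+* T') {n : ℕ}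
    (h : cohomologyAnnihilator T' = cohomologyAnnihilatorOfDegree T' n) :
    cohomologyAnnihilator T = cohomologyAnnihilatorOfDegree T n :=
  le_antisymm (cohomologyAnnihilator_le_of_ringEquiv e h.le) (cohomologyAnnihilatorOfDegree_le n)

end Transport

section IsLoc

variable {S : Type u} {B : Type u} [CommRing S] [CommRing B] [Algebra S B]

/-- **`IsLocalization` form of the localised hypersurface saturation** (o9c
`cohomologyAnnihilator_localization_eq_of_powerBasis` transported along `IsLocalization.algEquiv`):
for ANY `C` with `IsLocalization U C`, `U ⊆ B` a submonoid of an algebra `B` with a power basis over a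
noetherian `S` with `caᵈ⁺¹(S) = S`: `ca(C) = caᵈ⁺¹(C)`. [OURS] -/
theorem cohomologyAnnihilator_eq_of_isLocalization_powerBasis [IsNoetherianRing S]
    (pb : PowerBasis S B) {d : ℕ} (hvan : cohomologyAnnihilatorOfDegree S (d + 1) = ⊤)
    (U : Submonoid B) (C : Type u) [CommRing C] [Algebra B C] [IsLocalization U C] :
    cohomologyAnnihilator C = cohomologyAnnihilatorOfDegree C (d + 1) :=
  cohomologyAnnihilator_eq_of_ringEquiv
    (IsLocalization.algEquiv U C (Localization U)).toRingEquiv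
    (cohomologyAnnihilator_localization_eq_of_powerBasis pb hvan U)

/-- Any ring `T` ISOMORPHIC to a localisation `U⁻¹B` of a power-basis algebra `B` over a noetherian `S`
with `caᵈ⁺¹(S) = S` has `ca(T) = caᵈ⁺¹(T)` — the shape in which a tower stage `↥(tower A m)` (a
subalgebra of `K`) is matched with a local ring of a hypersurface chart. [OURS] -/
theorem cohomologyAnnihilator_eq_of_ringEquiv_localization_powerBasis [IsNoetherianRing S]
    (pb : PowerBasis S B) {d : ℕ} (hvan : cohomologyAnnihilatorOfDegree S (d + 1) = ⊤)
    (U : Submonoid B) {T : Type u} [CommRing T] (e : T ≃+* Localization U) :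
    cohomologyAnnihilator T = cohomologyAnnihilatorOfDegree T (d + 1) :=
  cohomologyAnnihilator_eq_of_ringEquiv e (cohomologyAnnihilator_localization_eq_of_powerBasis pb hvan U)

/-- **Regular LOCAL base.** For `S` a regular local ring of dimension `d`, `B` with a power basis over
`S` and any localisation `C` of `B`: `ca(C) = caᵈ⁺¹(C)` (tree
`cohomologyAnnihilatorOfDegree_eq_top_of_isRegularLocalRing` supplies `caᵈ⁺¹(S) = S`). [OURS] -/
theorem cohomologyAnnihilator_eq_of_isLocalization_powerBasis_of_isRegularLocalRing
    [IsRegularLocalRing S] {d : ℕ} (hd : ringKrullDim S = d) (pb : PowerBasis S B)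
    (U : Submonoid B) (C : Type u) [CommRing C] [Algebra B C] [IsLocalization U C] :
    cohomologyAnnihilator C = cohomologyAnnihilatorOfDegree C (d + 1) :=
  cohomologyAnnihilator_eq_of_isLocalization_powerBasis pb
    (cohomologyAnnihilatorOfDegree_eq_top_of_isRegularLocalRing (R := S) hd) U C

end IsLoc

section Stage

variable {k K : Type u} [Field k] [Field K] [Algebra k K]

/-- **Route-vocabulary adapter.** For a subalgebra stage `T ⊆ K`: if `ca(↥T) ⊆ caⁿ(↥T)` as ideals of
`↥T`, then the INLINE sets of the route file satisfy `ca T ⊆ caAt n T` — `ca`/`caAt` written out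
verbatim as in `Theses.HomologicalConductor.PersistenceSurface` / `PersistenceLevel.LevelPersistence`
(and o3 `SaturationFourSurface`, o6 `SaturationFourRational`), universe-polymorphically (the route
takes `u = 0`). [OURS] -/
theorem ca_subset_caAt_of_le (T : Subalgebra k K) {n : ℕ}
    (h : cohomologyAnnihilator ↥T ≤ cohomologyAnnihilatorOfDegree ↥T n) :
    {x : K | ∃ hx : x ∈ T, ∃ m : ℕ, ∀ i : ℕ, m ≤ i → ∀ (M N : ModuleCat.{u} ↥T),
        Module.Finite ↥T M → Module.Finite ↥T N →
          ∀ e : CategoryTheory.Abelian.Ext.{u} M N i, (⟨x, hx⟩ : ↥T) • e = 0} ⊆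
      {x : K | ∃ hx : x ∈ T, ∀ i : ℕ, n ≤ i → ∀ (M N : ModuleCat.{u} ↥T),
        Module.Finite ↥T M → Module.Finite ↥T N →
          ∀ e : CategoryTheory.Abelian.Ext.{u} M N i, (⟨x, hx⟩ : ↥T) • e = 0} := by
  rintro x ⟨hx, m, hm⟩
  have h1 : (⟨x, hx⟩ : ↥T) ∈ cohomologyAnnihilator ↥T :=
    mem_cohomologyAnnihilator_iff'.mpr ⟨m, hm⟩
  exact ⟨hx, mem_cohomologyAnnihilatorOfDegree_iff.mp (h h1)⟩

/-- **`Satₙ` at a tower stage that is a localised hypersurface**: if the stage `↥T` is ring-isomorphic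
to `U⁻¹B` for an algebra `B` with a power basis over a noetherian `S` with `caᵈ⁺¹(S) = S`, then
`ca T ⊆ caAt n T` for every `n ≥ d + 1` (route vocabulary). [OURS] -/
theorem ca_subset_caAt_of_ringEquiv_localization_powerBasis {S B : Type u} [CommRing S]
    [CommRing B] [Algebra S B] [IsNoetherianRing S] (pb : PowerBasis S B) {d : ℕ}
    (hvan : cohomologyAnnihilatorOfDegree S (d + 1) = ⊤) (U : Submonoid B) (T : Subalgebra k K)
    (e : ↥T ≃+* Localization U) {n : ℕ} (hn : d + 1 ≤ n) :
    {x : K | ∃ hx : x ∈ T, ∃ m : ℕ, ∀ i : ℕ, m ≤ i → ∀ (M N : ModuleCat.{u} ↥T),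
        Module.Finite ↥T M → Module.Finite ↥T N →
          ∀ e : CategoryTheory.Abelian.Ext.{u} M N i, (⟨x, hx⟩ : ↥T) • e = 0} ⊆
      {x : K | ∃ hx : x ∈ T, ∀ i : ℕ, n ≤ i → ∀ (M N : ModuleCat.{u} ↥T),
        Module.Finite ↥T M → Module.Finite ↥T N →
          ∀ e : CategoryTheory.Abelian.Ext.{u} M N i, (⟨x, hx⟩ : ↥T) • e = 0} :=
  ca_subset_caAt_of_le T
    ((cohomologyAnnihilator_eq_of_ringEquiv_localization_powerBasis pb hvan U e).le.trans
      (cohomologyAnnihilatorOfDegree_mono hn))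

/-- **`Sat₄` at a surface stage that is a local(ised) ring of `k₀[x,y][Z]/(f)`**, `f` monic in `Z`,
`k₀` any field (any characteristic): `ca T ⊆ ca⁴ T` in the route's vocabulary — the `m`-th conjunct of
`SaturationFourSurface` / `SaturationFourRational` for such a stage (indeed `ca = ca³` there). The
identification `e : ↥T ≃+* U⁻¹(k₀[x,y][Z]/(f))` of the stage is the consumer's input. [OURS] -/
theorem ca_subset_caAt_four_of_ringEquiv_localization_adjoinRoot (k₀ : Type u) [Field k₀]
    {f : Polynomial (MvPolynomial (Fin 2) k₀)} (hf : f.Monic) (U : Submonoid (AdjoinRoot f))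
    (T : Subalgebra k K) (e : ↥T ≃+* Localization U) :
    {x : K | ∃ hx : x ∈ T, ∃ m : ℕ, ∀ i : ℕ, m ≤ i → ∀ (M N : ModuleCat.{u} ↥T),
        Module.Finite ↥T M → Module.Finite ↥T N →
          ∀ e : CategoryTheory.Abelian.Ext.{u} M N i, (⟨x, hx⟩ : ↥T) • e = 0} ⊆
      {x : K | ∃ hx : x ∈ T, ∀ i : ℕ, 4 ≤ i → ∀ (M N : ModuleCat.{u} ↥T),
        Module.Finite ↥T M → Module.Finite ↥T N →
          ∀ e : CategoryTheory.Abelian.Ext.{u} M N i, (⟨x, hx⟩ : ↥T) • e = 0} :=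
  ca_subset_caAt_of_ringEquiv_localization_powerBasis (AdjoinRoot.powerBasis' hf)
    (cohomologyAnnihilatorOfDegree_mvPolynomial_eq_top k₀ 2) U T e (by norm_num)

/-- **`Satₙ` is trivial at REGULAR stages**: if the stage `↥T` is a regular local ring of dimension
`d`, then `caⁿ(↥T) = ↥T` for `n ≥ d + 1` (tree `cohomologyAnnihilatorOfDegree_eq_top_of_isRegularLocalRing`),
so `ca T ⊆ caAt n T` in the route's vocabulary (surface towers: `d ≤ 2 < 4`). [OURS] -/
theorem ca_subset_caAt_of_isRegularLocalRing (T : Subalgebra k K) [IsRegularLocalRing ↥T] {d : ℕ}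
    (hd : ringKrullDim ↥T = d) {n : ℕ} (hn : d + 1 ≤ n) :
    {x : K | ∃ hx : x ∈ T, ∃ m : ℕ, ∀ i : ℕ, m ≤ i → ∀ (M N : ModuleCat.{u} ↥T),
        Module.Finite ↥T M → Module.Finite ↥T N →
          ∀ e : CategoryTheory.Abelian.Ext.{u} M N i, (⟨x, hx⟩ : ↥T) • e = 0} ⊆
      {x : K | ∃ hx : x ∈ T, ∀ i : ℕ, n ≤ i → ∀ (M N : ModuleCat.{u} ↥T),
        Module.Finite ↥T M → Module.Finite ↥T N →
          ∀ e : CategoryTheory.Abelian.Ext.{u} M N i, (⟨x, hx⟩ : ↥T) • e = 0} :=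
  ca_subset_caAt_of_le T (le_trans le_top
    ((cohomologyAnnihilatorOfDegree_eq_top_of_isRegularLocalRing (R := ↥T) hd).ge.trans
      (cohomologyAnnihilatorOfDegree_mono hn)))

end Stage


end Summit.ResolutionOfSingularities.ResolutionOfSingularities.Theorems.HomologicalConductor.PeriodicSaturationStage

end
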